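import Mathlib
import Summits.ResolutionOfSingularities.ResolutionOfSingularities.Theorems.WildQuotientsWildQuotientResolutionToricExitTranslationFixed
import Summits.ResolutionOfSingularities.ResolutionOfSingularities.Theorems.WildQuotientsWildQuotientResolutionToricExitRootChartFour

/-!
# V4U root chart of `J₄`: fixed points of the triangular translation lie in `k[N, c′, d′, passengers]`

(crux stmt-ResolutionOfSingularities-15640 `WildQuotients.WildQuotientResolution`, line `Sketch`,
sector `|G| = p`; programme V4U of `L/w45c/CHAIN.md` v5 («then» of row stub-1; J₄ twin of
`ToricExit.mem_adjoin_of_rootChart_eq`, p488511); [OURS · L1 W4.5c] — NOT a statement of any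
manuscript; replaces the role of no printed item.)

For the root-chart action `σ_U` of `J₄` (`ρ = x_a ↦ ρ`, `β = x_b ↦ β + ρ`, `γ = x_c ↦ γ + ρβ`,
`δ = x_d ↦ δ + ργ`, passengers fixed; `a, b, c, d` distinct) over a field of characteristic
`p ≥ 5`, every `σ_U`-fixed polynomial lies in `k[N, c′, d′, xᵢ (i ∉ {b, c, d})]`
(`mem_adjoin_of_rootChart4_eq`), where `N = β^p − ρ^{p−1}β`,
`c′ = γ − ½(β² − ρβ)` (`= γ″/2`) and `d′ = δ − c′β − (β³ − 3ρβ² + 2ρ²β)/6` (`= δ″/6`,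
`…ToricExitRootChartFour`, p489957). Proof: the substitution `ψ : x_c ↦ c′, x_d ↦ d′` (inverse
`x_c ↦ x_c + ½(β² − ρβ)`, `x_d ↦ x_d + x_c β + (β³ − 3ρβ² + 2ρ²β)/6`) conjugates `σ_U` to the pure
translation `β ↦ β + ρ` (`rootChart4_conj`, because `σ_U c′ = c′`, `σ_U d′ = d′`), and
`ToricExit.mem_adjoin_of_translate_eq` (p488136, B1 transported) applies.
-/

-- single-problem summit: the doubled namespace component `ResolutionOfSingularities` is forced
set_option linter.dupNamespace false

noncomputable section

open MvPolynomial

namespace Summit.ResolutionOfSingularities.ResolutionOfSingularities.Theorems.WildQuotientResolution.ToricExit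

variable (k : Type) [Field k] (n : ℕ)
  (σU : MvPolynomial (Fin n) k ≃ₐ[k] MvPolynomial (Fin n) k) (a b c d : Fin n)
  (hab : a ≠ b) (hac : a ≠ c) (had : a ≠ d) (hbc : b ≠ c) (hbd : b ≠ d) (hcd : c ≠ d)
  (hb : σU (X b) = X b + X a) (hc : σU (X c) = X c + X a * X b)
  (hd : σU (X d) = X d + X a * X c)
  (hσ : ∀ i, i ≠ b → i ≠ c → i ≠ d → σU (X i) = X i)

include hab hac had hb hc hσ in
/-- `c′ = ½ γ″ = ½(2 x_c − β² + ρβ)` (`= x_c − ½(β² − ρβ)`) is `σ_U`-invariant: `γ″` is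
(`rootChart4_gamma_invariant`, every characteristic) and `σ_U` fixes constants. [folklore] -/
theorem rootChart4_half_gamma_invariant :
    σU (C (2⁻¹ : k) * (2 * X c - X b ^ 2 + X a * X b)) =
      C (2⁻¹ : k) * (2 * X c - X b ^ 2 + X a * X b) := by
  have ha : σU (X a) = X a := hσ a hab hac had
  have hC : σU (C (2⁻¹ : k)) = C (2⁻¹ : k) := σU.commutes (2⁻¹ : k)
  have h := rootChart4_gamma_invariant
    (σU : MvPolynomial (Fin n) k →+* MvPolynomial (Fin n) k) a b c ha hb hc
  rw [map_mul, hC]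
  congr 1

include hab hac had hb hc hd hσ in
/-- `d′ = x_d − c′β − (β³ − 3ρβ² + 2ρ²β)/6` is `σ_U`-invariant (`6 ∈ k×`). [folklore] -/
theorem rootChart4_dPrime (h2 : (2 : k) ≠ 0) (h6 : (6 : k) ≠ 0) :
    σU (X d - (C (2⁻¹ : k) * (2 * X c - X b ^ 2 + X a * X b)) * X b -
        C (6⁻¹ : k) * (X b ^ 3 - 3 * (X a * X b ^ 2) + 2 * (X a ^ 2 * X b))) =
      X d - (C (2⁻¹ : k) * (2 * X c - X b ^ 2 + X a * X b)) * X b -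
        C (6⁻¹ : k) * (X b ^ 3 - 3 * (X a * X b ^ 2) + 2 * (X a ^ 2 * X b)) := by
  have ha : σU (X a) = X a := hσ a hab hac had
  have hC2 : σU (C (2⁻¹ : k)) = C (2⁻¹ : k) := σU.commutes (2⁻¹ : k)
  have hC6 : σU (C (6⁻¹ : k)) = C (6⁻¹ : k) := σU.commutes (6⁻¹ : k)
  have h2C : (2 : MvPolynomial (Fin n) k) * C (2⁻¹ : k) = 1 := by
    rw [← map_ofNat C 2, ← map_mul, mul_inv_cancel₀ h2, map_one]
  have h6C : (6 : MvPolynomial (Fin n) k) * C (6⁻¹ : k) = 1 := by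
    rw [← map_ofNat C 6, ← map_mul, mul_inv_cancel₀ h6, map_one]
  have hu2 : IsUnit (2 : MvPolynomial (Fin n) k) := IsUnit.of_mul_eq_one _ h2C
  rw [← sub_eq_zero]
  refine (hu2.mul_right_eq_zero).mp ?_
  simp only [map_sub, map_mul, map_add, map_pow, map_ofNat, hC2, hC6, hb, ha, hc, hd]
  linear_combination (X a * X b ^ 2 - X a ^ 2 * X b - 2 * (X a * X c) : MvPolynomial (Fin n) k) *
      h2C + (X a ^ 2 * X b - X a * X b ^ 2 : MvPolynomial (Fin n) k) * h6C

include hab hac had hbc hbd hcd hb hc hd hσ in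
/-- **The conjugation for `J₄`**: with `τ` the pure translation `β ↦ β + ρ` and `ψ` the substitution
`x_c ↦ c′`, `x_d ↦ d′` (other variables fixed), `ψ (τ y) = σ_U (ψ y)` for all `y`. [folklore] -/
theorem rootChart4_conj (h2 : (2 : k) ≠ 0) (h6 : (6 : k) ≠ 0) (y : MvPolynomial (Fin n) k) :
    aeval (fun i : Fin n => if i = c then C (2⁻¹ : k) * (2 * X c - X b ^ 2 + X a * X b)
        else if i = d then X d - (C (2⁻¹ : k) * (2 * X c - X b ^ 2 + X a * X b)) * X b -
          C (6⁻¹ : k) * (X b ^ 3 - 3 * (X a * X b ^ 2) + 2 * (X a ^ 2 * X b))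
        else (X i : MvPolynomial (Fin n) k))
      (aeval (fun i : Fin n => if i = b then X b + X a else (X i : MvPolynomial (Fin n) k)) y) =
    σU (aeval (fun i : Fin n => if i = c then C (2⁻¹ : k) * (2 * X c - X b ^ 2 + X a * X b)
        else if i = d then X d - (C (2⁻¹ : k) * (2 * X c - X b ^ 2 + X a * X b)) * X b -
          C (6⁻¹ : k) * (X b ^ 3 - 3 * (X a * X b ^ 2) + 2 * (X a ^ 2 * X b))
        else (X i : MvPolynomial (Fin n) k)) y) := by
  classical
  set ψf : MvPolynomial (Fin n) k →ₐ[k] MvPolynomial (Fin n) k :=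
    aeval (fun i : Fin n => if i = c then C (2⁻¹ : k) * (2 * X c - X b ^ 2 + X a * X b)
        else if i = d then X d - (C (2⁻¹ : k) * (2 * X c - X b ^ 2 + X a * X b)) * X b -
          C (6⁻¹ : k) * (X b ^ 3 - 3 * (X a * X b ^ 2) + 2 * (X a ^ 2 * X b))
        else (X i : MvPolynomial (Fin n) k)) with hψf
  set τ : MvPolynomial (Fin n) k →ₐ[k] MvPolynomial (Fin n) k :=
    aeval (fun i : Fin n => if i = b then X b + X a else (X i : MvPolynomial (Fin n) k)) with hτ
  have ha : σU (X a) = X a := hσ a hab hac had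
  have hψa : ψf (X a) = X a := by rw [hψf, aeval_X, if_neg hac, if_neg had]
  have hψb : ψf (X b) = X b := by rw [hψf, aeval_X, if_neg hbc, if_neg hbd]
  have hψc : ψf (X c) = C (2⁻¹ : k) * (2 * X c - X b ^ 2 + X a * X b) := by
    rw [hψf, aeval_X, if_pos rfl]
  have hψd : ψf (X d) = X d - (C (2⁻¹ : k) * (2 * X c - X b ^ 2 + X a * X b)) * X b -
      C (6⁻¹ : k) * (X b ^ 3 - 3 * (X a * X b ^ 2) + 2 * (X a ^ 2 * X b)) := by
    rw [hψf, aeval_X, if_neg (Ne.symm hcd), if_pos rfl]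
  have key : ψf.comp τ = (σU : MvPolynomial (Fin n) k →ₐ[k] MvPolynomial (Fin n) k).comp ψf := by
    refine MvPolynomial.algHom_ext fun i => ?_
    change ψf (τ (X i)) = σU (ψf (X i))
    rw [hτ, aeval_X]
    by_cases hib : i = b
    · subst hib
      rw [if_pos rfl, map_add, hψa, hψb, hb]
    · rw [if_neg hib]
      by_cases hic : i = c
      · subst hic
        rw [hψc, rootChart4_half_gamma_invariant k n σU a b i d hab hac had hb hc hσ]
      · by_cases hid : i = d
        · subst hid
          rw [hψd, rootChart4_dPrime k n σU a b c i hab hac had hb hc hd hσ h2 h6]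
        · rw [hψf, aeval_X, if_neg hic, if_neg hid, hσ i hib hic hid]
  exact congrArg (fun φ : MvPolynomial (Fin n) k →ₐ[k] MvPolynomial (Fin n) k => φ y) key

include hab hac had hbc hbd hcd hb hc hd hσ in
/-- **Fixed points of the `J₄` root-chart action lie in `k[N, c′, d′, xᵢ (i ∉ {b,c,d})]`**
(`p ≥ 5`). [OURS · L1 W4.5c] -/
theorem mem_adjoin_of_rootChart4_eq (p : ℕ) (hp : p.Prime) (hp5 : 5 ≤ p) [CharP k p]
    (f : MvPolynomial (Fin n) k) (hf : σU f = f) :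
    f ∈ Algebra.adjoin k (({X b ^ p - X a ^ (p - 1) * X b,
        C (2⁻¹ : k) * (2 * X c - X b ^ 2 + X a * X b),
        X d - (C (2⁻¹ : k) * (2 * X c - X b ^ 2 + X a * X b)) * X b -
          C (6⁻¹ : k) * (X b ^ 3 - 3 * (X a * X b ^ 2) + 2 * (X a ^ 2 * X b))} :
        Set (MvPolynomial (Fin n) k)) ∪
      ((fun i => X i) '' {i | i ≠ b ∧ i ≠ c ∧ i ≠ d})) := by
  classical
  -- `2, 6 ≠ 0` in `k`
  have hndvd : ∀ m : ℕ, 0 < m → m < p → (m : k) ≠ 0 := by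
    intro m hm0 hmp h
    have hdvd : p ∣ m := (CharP.cast_eq_zero_iff k p m).mp h
    exact absurd (Nat.le_of_dvd hm0 hdvd) (not_le.mpr hmp)
  have h2 : (2 : k) ≠ 0 := by exact_mod_cast hndvd 2 (by norm_num) (by omega)
  have h6 : (6 : k) ≠ 0 := by
    intro h
    have hdvd : p ∣ 6 := (CharP.cast_eq_zero_iff k p 6).mp (by exact_mod_cast h)
    have hle : p ≤ 6 := Nat.le_of_dvd (by norm_num) hdvd
    interval_cases p <;> simp_all (config := {decide := true})
  have h2C : (2 : MvPolynomial (Fin n) k) * C (2⁻¹ : k) = 1 := by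
    rw [← map_ofNat C 2, ← map_mul, mul_inv_cancel₀ h2, map_one]
  set cP : MvPolynomial (Fin n) k := C (2⁻¹ : k) * (2 * X c - X b ^ 2 + X a * X b) with hcP
  set sP : MvPolynomial (Fin n) k :=
    C (6⁻¹ : k) * (X b ^ 3 - 3 * (X a * X b ^ 2) + 2 * (X a ^ 2 * X b)) with hsP
  set T := Algebra.adjoin k (({X b ^ p - X a ^ (p - 1) * X b, cP, X d - cP * X b - sP} :
      Set (MvPolynomial (Fin n) k)) ∪ ((fun i => X i) '' {i | i ≠ b ∧ i ≠ c ∧ i ≠ d})) with hT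
  set ψf : MvPolynomial (Fin n) k →ₐ[k] MvPolynomial (Fin n) k :=
    aeval (fun i : Fin n => if i = c then cP else if i = d then X d - cP * X b - sP
      else (X i : MvPolynomial (Fin n) k)) with hψf
  set ψg : MvPolynomial (Fin n) k →ₐ[k] MvPolynomial (Fin n) k :=
    aeval (fun i : Fin n => if i = c then X c + C (2⁻¹ : k) * (X b ^ 2 - X a * X b)
      else if i = d then X d + X c * X b + sP else (X i : MvPolynomial (Fin n) k)) with hψg
  set τ : MvPolynomial (Fin n) k →ₐ[k] MvPolynomial (Fin n) k :=
    aeval (fun i : Fin n => if i = b then X b + X a else (X i : MvPolynomial (Fin n) k)) with hτ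
  have hψa : ψf (X a) = X a := by rw [hψf, aeval_X, if_neg hac, if_neg had]
  have hψb : ψf (X b) = X b := by rw [hψf, aeval_X, if_neg hbc, if_neg hbd]
  have hψc : ψf (X c) = cP := by rw [hψf, aeval_X, if_pos rfl]
  have hψd : ψf (X d) = X d - cP * X b - sP := by
    rw [hψf, aeval_X, if_neg (Ne.symm hcd), if_pos rfl]
  have hψga : ψg (X a) = X a := by rw [hψg, aeval_X, if_neg hac, if_neg had]
  have hψgb : ψg (X b) = X b := by rw [hψg, aeval_X, if_neg hbc, if_neg hbd]
  have hψgc : ψg (X c) = X c + C (2⁻¹ : k) * (X b ^ 2 - X a * X b) := by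
    rw [hψg, aeval_X, if_pos rfl]
  have hψgd : ψg (X d) = X d + X c * X b + sP := by
    rw [hψg, aeval_X, if_neg (Ne.symm hcd), if_pos rfl]
  have hψC2 : ψf (C (2⁻¹ : k)) = C (2⁻¹ : k) := ψf.commutes (2⁻¹ : k)
  have hψC6 : ψf (C (6⁻¹ : k)) = C (6⁻¹ : k) := ψf.commutes (6⁻¹ : k)
  have hψgC2 : ψg (C (2⁻¹ : k)) = C (2⁻¹ : k) := ψg.commutes (2⁻¹ : k)
  have hψgC6 : ψg (C (6⁻¹ : k)) = C (6⁻¹ : k) := ψg.commutes (6⁻¹ : k)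
  -- `ψ`, `ψ⁻¹` fix `sP`; `ψ⁻¹ cP = x_c`
  have hψsP : ψf sP = sP := by
    rw [hsP, map_mul, hψC6, map_add, map_sub, map_pow, map_mul, map_mul, map_mul, map_pow,
      map_mul, map_pow, map_ofNat, map_ofNat, hψa, hψb]
  have hψgsP : ψg sP = sP := by
    rw [hsP, map_mul, hψgC6, map_add, map_sub, map_pow, map_mul, map_mul, map_mul, map_pow,
      map_mul, map_pow, map_ofNat, map_ofNat, hψga, hψgb]
  have hψgcP : ψg cP = X c := by
    rw [hcP, map_mul, map_add, map_sub, map_mul, map_pow, map_mul, map_ofNat, hψgC2, hψgb, hψga,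
      hψgc]
    linear_combination (X c + C (2⁻¹ : k) * (X b ^ 2 - X a * X b) : MvPolynomial (Fin n) k) * h2C
  have hfg : ∀ y, ψf (ψg y) = y := by
    have key : ψf.comp ψg = AlgHom.id k _ := by
      refine MvPolynomial.algHom_ext fun i => ?_
      change ψf (ψg (X i)) = X i
      by_cases hic : i = c
      · subst hic
        rw [hψgc, map_add, map_mul, map_sub, map_pow, map_mul, hψc, hψC2, hψb, hψa, hcP]
        linear_combination (X i : MvPolynomial (Fin n) k) * h2C
      · by_cases hid : i = d
        · subst hid
          rw [hψgd, map_add, map_add, map_mul, hψd, hψc, hψb, hψsP]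
          ring
        · rw [hψg, aeval_X, if_neg hic, if_neg hid, hψf, aeval_X, if_neg hic, if_neg hid]
    intro y
    exact congrArg (fun φ : MvPolynomial (Fin n) k →ₐ[k] MvPolynomial (Fin n) k => φ y) key
  have hgf : ∀ y, ψg (ψf y) = y := by
    have key : ψg.comp ψf = AlgHom.id k _ := by
      refine MvPolynomial.algHom_ext fun i => ?_
      change ψg (ψf (X i)) = X i
      by_cases hic : i = c
      · subst hic
        rw [hψc, hψgcP]
      · by_cases hid : i = d
        · subst hid
          rw [hψd, map_sub, map_sub, map_mul, hψgd, hψgcP, hψgb, hψgsP]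
          ring
        · rw [hψf, aeval_X, if_neg hic, if_neg hid, hψg, aeval_X, if_neg hic, if_neg hid]
    intro y
    exact congrArg (fun φ : MvPolynomial (Fin n) k →ₐ[k] MvPolynomial (Fin n) k => φ y) key
  -- `g = ψ⁻¹ f` is fixed by the translation
  have hτg : τ (ψg f) = ψg f := by
    have h1 : ψf (τ (ψg f)) = ψf (ψg f) := by
      rw [hψf, hcP, hsP, hτ, rootChart4_conj k n σU a b c d hab hac had hbc hbd hcd hb hc hd hσ h2 h6,
        ← hsP, ← hcP, ← hψf, hfg, hf]
    have h2' := congrArg ψg h1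
    rwa [hgf, hgf] at h2'
  have hg : ψg f ∈ Algebra.adjoin k (({X b ^ p - X a ^ (p - 1) * X b} :
      Set (MvPolynomial (Fin n) k)) ∪ ((fun i => X i) '' {i | i ≠ b})) :=
    mem_adjoin_of_translate_eq k n a b hab p hp (ψg f) hτg
  -- `f = ψ g ∈ ψ (k[N, xᵢ (i ≠ b)]) ≤ T`
  have hmap : Subalgebra.map ψf (Algebra.adjoin k (({X b ^ p - X a ^ (p - 1) * X b} :
      Set (MvPolynomial (Fin n) k)) ∪ ((fun i => X i) '' {i | i ≠ b}))) ≤ T := by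
    rw [AlgHom.map_adjoin, hT]
    refine Algebra.adjoin_le ?_
    rintro _ ⟨g, hg', rfl⟩
    rcases hg' with hg' | ⟨i, hib, rfl⟩
    · rw [Set.mem_singleton_iff] at hg'
      subst hg'
      rw [map_sub, map_pow, map_mul, map_pow, hψb, hψa]
      exact Algebra.subset_adjoin (Or.inl (Set.mem_insert _ _))
    · by_cases hic : i = c
      · subst hic
        change ψf (X i) ∈ _
        rw [hψc]
        exact Algebra.subset_adjoin (Or.inl (Set.mem_insert_of_mem _ (Set.mem_insert _ _)))
      · by_cases hid : i = d
        · subst hid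
          change ψf (X i) ∈ _
          rw [hψd]
          exact Algebra.subset_adjoin
            (Or.inl (Set.mem_insert_of_mem _ (Set.mem_insert_of_mem _ (Set.mem_singleton _))))
        · change ψf (X i) ∈ _
          rw [hψf, aeval_X, if_neg hic, if_neg hid]
          exact Algebra.subset_adjoin (Or.inr ⟨i, ⟨hib, hic, hid⟩, rfl⟩)
  rw [← hfg f]
  exact hmap (Subalgebra.mem_map.mpr ⟨ψg f, hg, rfl⟩)

end Summit.ResolutionOfSingularities.ResolutionOfSingularities.Theorems.WildQuotientResolution.ToricExit

end
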